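import Summits.QuantumFields.YangMills.Theses.UnitScaleTilt
import Literature.MathematicalPhysics.QuantumFieldTheory.Balaban1983to89.T3PrintedRegularMinimiser
import Literature.MathematicalPhysics.QuantumFieldTheory.Balaban1983to89.T3SmallLiftHistory
import Literature.MathematicalPhysics.QuantumFieldTheory.Balaban1983to89.T3AlphaInputsACTwoRun
import Summits.QuantumFields.YangMills.Theorems.UnitScaleTiltFluctuationComparisonRegPrOneStepSubmersion
import Summits.QuantumFields.YangMills.Theorems.UnitScaleTiltFluctuationComparisonRegPrSocket
import Summits.QuantumFields.YangMills.Theorems.AlphaInputsT3AC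
import Summits.QuantumFields.YangMills.Theorems.UnitScaleTiltFluctuationComparisonRegPrLevelCauchyMin
import Summits.QuantumFields.YangMills.Theorems.UnitScaleTiltFluctuationComparisonRegPrLevelCauchyMinT
import Summits.QuantumFields.YangMills.Theorems.UnitScaleTiltFluctuationComparisonRegPrAlphaTwoRunAdapterT
import Summits.QuantumFields.YangMills.Theorems.UnitScaleTiltFluctuationComparisonRegPrRepAtHeightsV3Fam
import Summits.QuantumFields.YangMills.Theorems.AlphaInputsT3ACv3Data
import HarnessLib

/-!
# BC3 birth skeleton **v5j′ («family» variant)** — = v5j (below) with STUB 3″ stated over an EXISTENTIALLY QUANTIFIED ADMISSIBLE FAMILY of v3 packages instead of the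
# `Classical.choice` datum (FINDING F-g4-1 of ★ym-ust-19201-p2 g4, 2026-08-27): `stub_pintDecompTwoRunMinFam : … (h : OfV3At F (hF ▸ 𝔠) a₀ a₁) → ∃ (p : ∀ K, PkgAtV3 F (hF ▸ 𝔠) γ hγ hγ1 K),
# (∀ K, (p K).a₀ = a₀ ∧ (p K).a₁ = a₁) ∧ ∃ π PT, PintDecompTrivT (dataOfV3 p π) PT ∧ TwoRunMinT (dataOfV3 p π) PT (hF ▸ 𝔠).b₀ (hF ▸ 𝔠).p₀ a`.  WHY: the v3 datum `OfV3At.dataT3v3`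
# reads, at each run `K`, an INDEPENDENT `Classical.choice` among the admissible packages of run `K`; a cross-`K` row ((C)'s `PolymerCauchyMinAtT`) about two independent
# choices is provable only if it holds for EVERY pair of admissible packages — which the booked slack of the step rows forbids (admissible top-level activities carry a
# `K`-independent relative freedom at fixed height; the two-run budget decays like `L^{−a(K−n)}`).  The family form is provable in principle (by a COHERENT admissible family —
# the canonical expansions) and equal to v5j in every other byte; conjunct (A) for `dataOfV3 p π` holds for EVERY admissible family (`AlphaInputsT3AC.repAtHeights_dataOfV3`,
# this seat's `…RepAtHeightsV3Fam{Base,}.lean`).  ns `…BirthV5jFam`.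
#
# (v5j header, kept:) BC3 birth skeleton **v5j** — THE v3 (α)-SOCKET RE-BASE of crux `FluctuationComparisonRegPrL` (stmt-QuantumFields-19935), OWNER RULING g19-№2 (ym3-torus-plan g19,
# 2026-08-27T07:38Z; pen ★ym-ust-19201-p2 g4): = v5i (evidence #35, 91e9c1fcd32391d1; = registered v5h a621e9fb in the stub1landed bytes f93786f7 with STUB 3′ read over a
# coarse-field-indexed term function `PT : TermFn F`) ∘ { STUB 2′ ↦ `stub_laneRecordsV3 : ∀ L, Odd L → 1 < L → AlphaInputsT3ACv3Rec L` (★alpha-1's v3 record-parametric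
# socket, `AlphaInputsT3ACv3.lean`; RULING g18-№3 §3 / SUPPLEMENT A: print's (55) with `χ_{k+1}` on the right over PINNED masses `M(triv) ≡ 1`, E6′-free; byte-identical
# with the 19936 skeleton v5p6); `OfV2At ↦ OfV3At`, `pkgAtV2 ↦ pkgAtV3`, `dataT3c ↦ dataT3v3`; STUB 3′ ↦ conjunct (A) `RepAtHeights (dataT3v3 …)` PROVED BY NAME
# (`OfV3At.repAtHeights_dataT3v3`, this seat's `…RepAtHeightsV3{Base,}.lean`, from `PkgAtV3.fibre55Win … (Hist.triv …)` + `fibre57Low` + r1 — no extra row) + ONE STUB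
# `stub_pintDecompTwoRunMinT` := rows (B)∧(C) of `LogComparisonAlphaAdapter.stub_alphaTwoRunOfLaneT_of_rows` (p509517) VERBATIM at the v3 datum under the registered outer
# prefix (ONE `∃ π ∃ PT` shared by `PintDecompTrivT ∧ TwoRunMinT`; residual inside it = `PolymerCauchyMinAtT`, XL, located-UNPRINTED non-abelian d = 3); §2 derives the
# α-adapter `alphaTwoRunOfLaneV3` (the v5i STUB 3′ conclusion) sorry-free with the thresholds discharged (`LogComparisonAlphaAdapter.exists_gamma_thresholds`), then
# `logComparisonRegPrL` / `FluctuationComparisonRegPrL_of` BY NAME exactly as v5i; STUB 1 landed, STUB 4′ verbatim, `landed_levelCauchyOfTwoRunMinT` := p509040;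
# ns `…BirthV5j` }.  THREE active stubs {`stub_laneRecordsV3`, `stub_pintDecompTwoRunMinT`, `stub_logComparisonSmallBlocks`}; sorries ONLY there.
#
# (v5i header, kept:) BC3 birth skeleton **v5i** — PROPOSAL of fleet seat ym-ust-19201-p2 g4 (2026-08-27) for the route owner: = the registered v5h (a621e9fb492a9f9b) in the
# «stub1landed» bytes (f93786f757a13db4, owner-endorsed 04:09:22Z) with ONE re-cut — STUB 3′'s polymer conjuncts read over a COARSE-FIELD-INDEXED term
# function `PT : TermFn F` (`T3AlphaInputsACTwoRunLevel` §4, p507948; ★alpha-1 F-α1-5): conclusion `∃ (D : AlphaDataT3 F γ) (PT : TermFn F), RepAtHeights D 𝔠.b₀ 𝔠.p₀ ε₀ ∧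
# PintDecompTrivT D PT ∧ TwoRunMinT D PT 𝔠.b₀ 𝔠.p₀ a`; the S-E″ row becomes `landed_levelCauchyOfTwoRunMinT := LogComparisonLevelCauchyMinT.levelCauchyOfTwoRunMinT_dec`
# (p509040); §2 destructures `⟨D, PT, …⟩`; every other byte identical.  WHY: the lane's (43)-terms are (history, coarse-field)-indexed (`Carriers.StepSeries`), so the
# fine-field `PintDecomp`/`TwoRunMin` have no honest lane instance, while `Umin` is otherwise unconstrained in STUB 3′ (equal strength; anti-junk unchanged:
# `TermSizeTrivT` carries no volume factor).  With it STUB 3′ is CLOSED MODULO TWO NAMED LANE ROWS, thresholds discharged (p509517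
# `LogComparisonAlphaAdapter.stub_alphaTwoRunOfLaneT_of_rows`: rowA = `PinnedStep.Fibre55WinAC` at the trivial history; rowBC = `PintDecompTrivT ∧ TwoRunMinT` for `dataT3c`).
#
# (v5j′ REV 2, owner ym3-torus-plan g20, 2026-08-27 F-owner-g20-2: STUB 1 RE-LISTED as an explicit hypothesis — p490827's L = 3 branch rests on `native_decide`
# certificates (`…CertL3Tree` faceQ/sneutralQ/massQ/chainMassQ/rowsQ), inadmissible under the gate's closure policy; `posOnSmall` := p446430 ∘ STUB 1; sorries 3 → 4.)
# (PATCH «stub1landed», seat ym-ust-19201-p1 g3, 2026-08-27: STUB 1 := landed `ApproxLift.AnsatzT.stub_oneStepSmallLift` p490827,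
# `posOnSmall` := landed `Theorems.PosOnSmall.posOnSmall` p494511; every other byte identical to the registered v5h a621e9fb492a9f9b; sorries 4 → 3.)
# BC3 birth skeleton v5h — OWNER CUT for the NEW load-bearing item `FluctuationComparisonRegPrL` (stmt-QuantumFields-19935)
# (route owner ym3-torus-plan g17, 2026-08-27; OWNER RULING g17-№1 §C; ERRATUM v3′ «for all sufficiently large (b₀,p₀)», route rev 6–9)

= ★ym-ust-19201-p2 g2's v5g PROPOSAL (211430dd17819b1d, evidence #49 on the aside item stmt-QuantumFields-19201) ACCEPTED IN SUBSTANCE — four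
stubs, the α-adapter PACKAGE-FREE (`RepAtHeights ∧ PintDecomp ∧ TwoRunMin`), S-E″ = the landed `LogComparisonLevelCauchyMin.levelCauchyOfTwoRunMin_dec`
(p479478), e1 folded (finding #47), positivity from STUB 1 + landed submersion — and RE-CUT for the owner finding F-owner-g17-1 ((b₀,p₀)-EXACTNESS:
a run with constants record `𝔠` serves the profile (b₀,p₀) iff its p-function IS `θBal F.L γ b₀ p₀`; print and the Balaban3D lane run only for
«b₀ a sufficiently large absolute constant, p₀ > 2», [Balaban1985UV3] (7) p.257; lane `AlphaConsts.p₀ = 2r₀+1 ≥ 3`, `AlphaConsts.b₀ ≥ √448`):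
* STUB 2′ `stub_laneRecords` (replaces v5g's `stub_laneInputsT3`, ONE record per L is not enough) := ★alpha-1's LANDED record-parametric closed Prop
  `Theorems.AlphaInputsT3ACv2Rec L` BY NAME (p481577): for every odd L > 1 there are thresholds (b₁,p₁) such that EVERY profile (b₀,p₀) ⪰ (b₁,p₁) is the
  (b₀,p₀) of some constants record 𝔠, with [Balaban1985Variational] constants a₀ a₁ bound WITH the record (F-α1-8: «depend on d and L only»), whose v2 (α)
  rows `AlphaInputsT3AC.OfV2At F 𝔠 a₀ a₁` hold for every family of block size L (shared verbatim with the 19936 skeleton; one discharge serves both lines).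
* STUB 3′ `stub_alphaTwoRunOfLane`: v5g's text with «∀ (b₀ p₀ : ℝ), 0 < b₀ → 2 < p₀ →» DELETED, the conclusion read at the record's OWN constants
  `𝔠.b₀ 𝔠.p₀` (the v5g order «∀ 𝔠 … ∀ b₀ p₀» is undischargeable: instance p₀ := 𝔠.p₀ + 7), and the α-hypothesis re-pointed to the v2 rows AT GIVEN
  constants `AlphaInputsT3AC.OfV2At F (hF ▸ 𝔠) a₀ a₁` (so the adapter may take ε₁ := a₀, family-uniform — ★alpha-1 01:18:27Z).
* STUB 4′ `stub_logComparisonSmallBlocks` (odd L < 7 residue): threshold form, thresholds FIRST (then (b₀,p₀), ε₁, m₀, γ₁), body byte-identical.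
* STUB 1, `landed_oneStepSubmersion`, `landed_levelCauchyOfTwoRunMin`, `posOnSmall`: byte-identical to v5g.
* §2 concludes `Summit.QuantumFields.YangMills.Theses.UnitScaleTilt.FluctuationComparisonRegPrL` BY NAME (`FluctuationComparisonRegPrL_of`): thresholds :=
  those of STUB 2′ (L ≥ 7) / STUB 4′ (L < 7); for L ≥ 7 the record with (𝔠.b₀, 𝔠.p₀) = (b₀,p₀) is obtained and `subst`ituted, STUB 3′ gives ε₁(𝔠), a(𝔠),
  the landed S-E″ gives m₀ — ε₁ and m₀ may depend on the record, which the v3′ quantifier order (thresholds first) allows.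
Sorries ONLY in the four `stub_*`.  [cite: Balaban1985UV3, Thm 2 p.272 and (7) p.257; King1986, Prop. 3.8-3.9 pp.664-665, Thm 3.4 (3.9) p.656]
-/

set_option autoImplicit false

noncomputable section

namespace Summit.QuantumFields.YangMills.Cruxes.FluctuationComparisonRegPrL.BirthV5jFam

open MeasureTheory Filter Topology
open Literature.MathematicalPhysics.QuantumFieldTheory.Balaban1983to89
open Literature.MathematicalPhysics.QuantumFieldTheory.Balaban1983to89.T3ContinuumYM3Torus
open Literature.MathematicalPhysics.QuantumFieldTheory.Balaban1983to89.T3LevelShift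
open Literature.MathematicalPhysics.QuantumFieldTheory.Balaban1983to89.T3UnitLawDensityEML (ℰp measurableE_ℰp)
open Literature.MathematicalPhysics.QuantumFieldTheory.Balaban1983to89.T3UnitScaleTilt
open Literature.MathematicalPhysics.QuantumFieldTheory.Balaban1983to89.T3RestrictedUnitDensity
open Literature.MathematicalPhysics.QuantumFieldTheory.Balaban1983to89.T3TiltDescent
open Literature.MathematicalPhysics.QuantumFieldTheory.Balaban1983to89.T3ConstrainedMinimiser
open Literature.MathematicalPhysics.QuantumFieldTheory.Balaban1983to89.T3RegularMinimiser
open Literature.MathematicalPhysics.QuantumFieldTheory.Balaban1983to89.T3PrintedRegularMinimiser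
open Literature.MathematicalPhysics.QuantumFieldTheory.Balaban1983to89.T3SmallLiftHistory
open Literature.MathematicalPhysics.QuantumFieldTheory.Balaban1983to89.T3LogComparisonSocket
open Literature.MathematicalPhysics.QuantumFieldTheory.Balaban1983to89.T3AlphaInputsAC
open Literature.MathematicalPhysics.QuantumFieldTheory.Balaban1983to89.T3AlphaInputsACTwoRun
open Literature.MathematicalPhysics.QuantumFieldTheory.Balaban1983to89.T3AlphaInputsACTwoRunLevel
open Literature.MathematicalPhysics.QuantumFieldTheory.Balaban1983to89.Missing
open Literature.MathematicalPhysics.QuantumFieldTheory.Balaban1983to89.T4Continuum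

/-! ## §1 Registered stubs (sorries live ONLY here) -/

/-- STUB 1 (L; W7) — RE-LISTED AS AN EXPLICIT HYPOTHESIS at v5j′ REV 2 (owner ym3-torus-plan g20, 2026-08-27, F-owner-g20-2): its proof of record
`Theorems.ApproxLift.AnsatzT.stub_oneStepSmallLift` (p490827) is LANDED but its L = 3 branch rests on FIVE `native_decide` certificates
(`…FluctuationComparisonRegPrCertL3Tree` `faceQ`/`sneutralQ`/`massQ`/`chainMassQ`/`rowsQ`, axioms `…_native.native_decide.ax_1_1` ∉ {propext, Classical.choice, Quot.sound}),
which the gate's skeleton/closure policy does not admit («axioms never close anything — prove it or make it an explicit listed hypothesis»); it is therefore a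
STUB again until a kernel-checked (de-nativised) proof of the same five certificate theorems lands, after which it closes BY NAME with the text below unchanged
(byte-identical with v5h's STUB 1) — ONE-STEP SMALL LIFT with gain `κ√L ≤ 1` for every family of block size `L` (linearisation certified; non-linear step =
implicit function on `SU(2)^{bonds}`). [cite: Balaban1987RG1, (0.4)/(0.18) p.253] -/
theorem stub_oneStepSmallLift :
    ∀ L : ℕ, ∃ κ δ₀ : ℝ, κ * Real.sqrt L ≤ 1 ∧ 0 < δ₀ ∧
      ∀ F : T3Family, F.L = L → OneStepSmallLift F ℰp κ δ₀ := by
  sorry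

/-- LANDED (was STUB 2 of v3, `stub_oneStepSubmersion`): the ONE-STEP SUBMERSION (O) ∧ (N) of the (0.4)/EML averaging on small `SU(2)`
fields — PROVED by the fleet lead ym-ust-19201-p1, `Theorems.OneStepSubmersion.oneStepSubmersion_family` (p446430; engines p443878 fibrewise
submersion, p444734/p445163 parametric IFT on `SU(2)` in the cone picture, p445817 analytic datum of the EML fibre map).  Renamed `landed_…` so the
registrar does not resurrect it as a stub (cf. 19200 v3d). [cite: Balaban1987RG1, (0.4) p.253] -/
theorem landed_oneStepSubmersion :
    ∀ L : ℕ, ∃ δ₁ : ℝ, 0 < δ₁ ∧ ∀ F : T3Family, F.L = L → ∀ K j : ℕ, j + 1 ≤ F.m + K →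
      (∀ O : Set (GaugeField (F.P K) j (Matrix.specialUnitaryGroup (Fin 2) ℂ)), IsOpen O → O ⊆ {U | PlaqSmall δ₁ U} →
        IsOpen ((BlockAveraging.blockAvg (P := F.P K) (j := j) ℰp).avg '' O)) ∧
      (∀ O : Set (GaugeField (F.P K) j (Matrix.specialUnitaryGroup (Fin 2) ℂ)), IsOpen O → O ⊆ {U | PlaqSmall δ₁ U} →
        ∀ A : Set (GaugeField (F.P K) (j + 1) (Matrix.specialUnitaryGroup (Fin 2) ℂ)), MeasurableSet A →
          fieldMeasure (F.P K) j (Matrix.specialUnitaryGroup (Fin 2) ℂ)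
              (O ∩ (BlockAveraging.blockAvg (P := F.P K) (j := j) ℰp).avg ⁻¹' A) = 0 →
            fieldMeasure (F.P K) (j + 1) (Matrix.specialUnitaryGroup (Fin 2) ℂ)
              (A ∩ (BlockAveraging.blockAvg (P := F.P K) (j := j) ℰp).avg '' O) = 0) :=
  Summit.QuantumFields.YangMills.Theorems.OneStepSubmersion.oneStepSubmersion_family

/-- STUB 2′ (XXL but LANE-OWNED; owner's `stub_laneRecordsV3`, RULING g18-№3 §3 / SUPPLEMENT A / g19-№2; the END theorem of cell pub-balaban3d modulo NODE O, run with the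
power-counting profile as a PARAMETER) — BAŁABAN'S (α) INPUT ROWS, VERSION 3, HOLD FOR THE PINNED CARRIER AT EVERY SUFFICIENTLY LARGE PROFILE: for every admissible block size
there are thresholds `(b₁, p₁)` such that every profile `(b₀, p₀) ⪰ (b₁, p₁)` is the profile of SOME primitive-constants record `𝔠 : AlphaConsts L 2` (`𝔠.b₀ = b₀`,
`𝔠.p₀ = p₀`) with [7]-constants `a₀ a₁` bound with the record, whose v3 AC (α) rows `AlphaInputsT3AC.OfV3At F 𝔠 a₀ a₁` hold for every family with `F.L = L` — ★alpha-1's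
closed Prop `Theorems.AlphaInputsT3ACv3Rec L` BY NAME.  v3 = the (β) residual rows are print's (55) WITH `χ_{k+1}` on the right and (57), over PINNED exact-transport masses
(`MassesPAC`, `m(triv) = 1`), the Jacobian of `blockAvg ℰp` inside the step pieces at (46)-size; exact Haar compatibility E6′ is NOT a row (replaces v2's `AlphaInputsT3ACv2Rec`,
retired by located point P-g18-1).  SHARED verbatim with the `HistoryTailL` (stmt-QuantumFields-19936) skeleton v5p6. [cite: Balaban1985UV3, Thm 1 p.257, (7) p.257, (55) p.269 and Thm 2 p.272] -/
theorem stub_laneRecordsV3 : ∀ L : ℕ, Odd L → 1 < L → Summit.QuantumFields.YangMills.Theorems.AlphaInputsT3ACv3Rec L := by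
  sorry

/-- STUB 3″′ (XL–XXL, THE CORE; «family» form of the owner's `stub_pintDecompTwoRunMinT`, RULING g19-№2 (2) + FINDING F-g4-1): FOR A CONSTANTS RECORD `𝔠` WITH
[7]-CONSTANTS `a₀ a₁` there are ONE exponent `a(𝔠) > 0` and a coupling threshold `γB(𝔠) > 0` such that for every family of block size `L`, every admissible coupling below it
and every inhabitant `h` of the v3 package there is a COHERENT ADMISSIBLE FAMILY of v3 packages `p : ∀ K, PkgAtV3 F 𝔠 γ hγ hγ1 K` carrying the given constants, a polymer
parameter `π` and a coarse-field-indexed term function `PT` (`T3AlphaInputsACTwoRunLevel` §4) with, for the family's datum `AlphaInputsT3AC.dataOfV3 p π`: (B) the trivial-history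
(43)-decomposition `PintDecompTrivT` (re-indexing of `Carriers.pintOfSeries = PoldIn + PY + PYZ` through `StepAlphaV3AC.hPY/hPYZ` and `oldSum/oldVal`, M) AND (C) the folded
two-run bundle `TwoRunMinT … 𝔠.b₀ 𝔠.p₀ a` — (44) at the trivial history on the window, summable / block-volume / matched localisation domains across the two cut-offs, and
the per-polymer cut-off comparison `PolymerCauchyMinAtT` between the members `p (K+1)` and `p K` read at the SAME datum (King's matched-step activity replacement,
[King1986] §3.4–3.5, Props 3.8–3.10 the abelian template; located, UNPRINTED for non-abelian d = 3 — the residual of the crux).  The family is ∃-quantified ONCE for all `K`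
(two independent per-`K` choices cannot carry a cross-`K` row); `h` certifies that admissible packages exist at every `K`.  ONE `∃ p ∃ π ∃ PT` shared by (B) and (C).
[cite: Balaban1985UV3, (43)-(46) pp.266-267; King1986, Prop. 3.8-3.9 pp.664-665] -/
theorem stub_pintDecompTwoRunMinFam :
    ∀ (L : ℕ), Odd L → 7 ≤ L → ∀ (𝔠 : Summit.QuantumFields.Balaban3D.Proofs.Primitives.AlphaConsts L (Summit.QuantumFields.Balaban3D.Carriers.suGroupModel 2).N)
      (a₀ a₁ : ℝ), 0 < a₀ → 0 < a₁ → 𝔠.B₃ * a₁ ≤ a₀ →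
      ∃ a : ℝ, 0 < a ∧ ∃ γB : ℝ, 0 < γB ∧ ∀ (F : T3Family) (γ : ℝ) (hF : F.L = L) (hγ : 0 < γ), γ ≤ γB →
        ∀ (hγ1 : γ ≤ (min (hF ▸ 𝔠).gamma0 1) ^ 2),
          Summit.QuantumFields.YangMills.Theorems.AlphaInputsT3AC.OfV3At F (hF ▸ 𝔠) a₀ a₁ →
          ∃ (p : ∀ K, Summit.QuantumFields.YangMills.Theorems.AlphaInputsT3AC.PkgAtV3 F (hF ▸ 𝔠) γ hγ hγ1 K),
            (∀ K, (p K).a₀ = a₀ ∧ (p K).a₁ = a₁) ∧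
            ∃ (π : Summit.QuantumFields.YangMills.Theorems.AlphaInputsT3AC.PolymerT3 F) (PT : TermFn F),
              PintDecompTrivT (Summit.QuantumFields.YangMills.Theorems.AlphaInputsT3AC.dataOfV3 p π) PT ∧
                TwoRunMinT (Summit.QuantumFields.YangMills.Theorems.AlphaInputsT3AC.dataOfV3 p π) PT (hF ▸ 𝔠).b₀ (hF ▸ 𝔠).p₀ a := by
  sorry

/-- LANDED (was STUB S-E″ `stub_levelCauchyOfSchemas` of v5c/v5d + STUB e1 `stub_minimiserCauchy`; v5g THEOREM, renamed `landed_…` so the registrar does not resurrect it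
as a stub): for EVERY exponent `a > 0`, with `m₀ = ⌈(3+b)/b⌉ + 1`, `b = min(a, 1)` and NO real threshold (`ε₁ = γ₁ = 1`): the (43)-decomposition `PintDecomp D` and the folded
two-run bundle over a term function `TwoRunMinT D PT b₀ p₀ a` (with `PintDecompTrivT D PT`) give the cut-off-Cauchy property `CauchyAtHeights D b₀ p₀ m` — PURE COUNTING
(v5i: `LogComparisonLevelCauchyMinT.levelCauchyOfTwoRunMinT_dec`, p509040; the v5h row `LogComparisonLevelCauchyMin.levelCauchyOfTwoRunMin_dec` p479478 is its `ptermMin` instance). [cite: King1986, Thm 3.4 (3.9) p.656 and (3.12)-(3.13) p.657] -/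
theorem landed_levelCauchyOfTwoRunMinT :
    ∀ (L : ℕ), Odd L → 1 < L → ∀ (a : ℝ), 0 < a →
      ∃ ε₁ : ℝ, 0 < ε₁ ∧ ∀ (ε₀ : ℝ), 0 < ε₀ → ε₀ ≤ ε₁ → ∃ m₀ : ℕ, ∀ (m : ℕ), m₀ ≤ m → ∀ (b₀ p₀ : ℝ), 0 < b₀ → 2 < p₀ →
        ∃ γ₁ : ℝ, 0 < γ₁ ∧ ∀ (F : T3Family) (γ : ℝ), F.L = L → 0 < γ → γ ≤ γ₁ →
          ∀ (D : AlphaDataT3 F γ) (PT : TermFn F), PintDecompTrivT D PT → TwoRunMinT D PT b₀ p₀ a → CauchyAtHeights D b₀ p₀ m :=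
  Summit.QuantumFields.YangMills.Theorems.LogComparisonLevelCauchyMinT.levelCauchyOfTwoRunMinT_dec

/-- STUB 4′ — SMALL-BLOCK SUPPLEMENT (rank-last; XL; located-UNPRINTED; owner rulings g16-№1 / g17-№1): the v2–v4 registered STUB-3 body ON odd
`L < 7`, i.e. L ∈ {3, 5} (the block sizes at which the large-L line cannot run AS TYPED — socket window edge band, FINDING #44/#56 on 19201), in the
ERRATUM-v3′ THRESHOLD FORM: thresholds `(b₁, p₁)` FIRST, then the profile, then `ε₁, m₀, γ₁`.  Line foreseen: (R1) print's χ back / (R2′) shrunken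
window inside the proof / (R0) height guard — see the v5d docstring on the aside item; not staffed before the large-L chain closes.
[cite: Balaban1985UV3, (47) p.267; King1986, Thm 3.4 (3.9) p.656] -/
theorem stub_logComparisonSmallBlocks :
    ∀ (L : ℕ), Odd L → 1 < L → L < 7 → ∃ (b₁ p₁ : ℝ), ∀ (b₀ p₀ : ℝ), b₁ ≤ b₀ → p₁ ≤ p₀ → 0 < b₀ → 2 < p₀ →
      ∃ ε₁ : ℝ, 0 < ε₁ ∧ ∀ (ε₀ : ℝ), 0 < ε₀ → ε₀ ≤ ε₁ → ∃ m₀ : ℕ, ∀ (m : ℕ), m₀ ≤ m →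
        ∃ γ₁ : ℝ, 0 < γ₁ ∧ ∀ (F : T3Family) (γ : ℝ), F.L = L → 0 < γ → γ ≤ γ₁ →
          ∃ (r κ : ℕ → ℝ), Summable r ∧ (∀ K, 0 ≤ r K) ∧
            ∀ K, ∀ᵐ V ∂fieldMeasure (F.P (K / m)) 0 (Matrix.specialUnitaryGroup (Fin 2) ℂ),
              PlaqSmall (θBal F.L γ b₀ p₀ (K / m)) V →
                0 < heightDensity F γ (Nat.div_le_self K m) (histGood F ℰp (θBal F.L γ b₀ p₀) K (K / m)) V →
                0 < heightDensity F γ ((Nat.div_le_self K m).trans (Nat.le_succ K))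
                      (histGood F ℰp (θBal F.L γ b₀ p₀) (K + 1) (K / m)) V →
                  |(Real.log (heightDensity F γ ((Nat.div_le_self K m).trans (Nat.le_succ K))
                        (histGood F ℰp (θBal F.L γ b₀ p₀) (K + 1) (K / m)) V) + bgRegPr' F γ m ε₀ K V) -
                    (Real.log (heightDensity F γ (Nat.div_le_self K m) (histGood F ℰp (θBal F.L γ b₀ p₀) K (K / m)) V) + bgRegPr F γ m ε₀ K V) -
                      κ K| ≤ r K := by
  sorry

/-! ## §2 The composition — NO sorry below this line -/

/-- **THE α-ADAPTER OVER `TermFn` AT THE v3 PACKAGE — A THEOREM** (v5i's STUB 3′ conclusion; RULING g19-№2 (2)): conjunct (A) by `AlphaInputsT3AC.repAtHeights_dataOfV3` for the family the stub provides (this seat's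
`…RepAtHeightsV3Fam.lean`), rows (B)∧(C) by STUB 3″′, thresholds `ε₁ := a₀`, `γ₁(𝔠, ε₀) := min(γB, γ_thresholds, (min γ₀ 1)²)` (`LogComparisonAlphaAdapter.exists_gamma_thresholds`,
p509517).  [cite: Balaban1985UV3, Thm 2 p.272; King1986, Prop. 3.8-3.9 pp.664-665] -/
theorem alphaTwoRunOfLaneV3 :
    ∀ (L : ℕ), Odd L → 7 ≤ L → ∀ (𝔠 : Summit.QuantumFields.Balaban3D.Proofs.Primitives.AlphaConsts L (Summit.QuantumFields.Balaban3D.Carriers.suGroupModel 2).N)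
      (a₀ a₁ : ℝ), 0 < a₀ → 0 < a₁ → 𝔠.B₃ * a₁ ≤ a₀ →
      ∃ ε₁ : ℝ, 0 < ε₁ ∧ ∃ a : ℝ, 0 < a ∧ ∀ (ε₀ : ℝ), 0 < ε₀ → ε₀ ≤ ε₁ →
        ∃ γ₁ : ℝ, 0 < γ₁ ∧ ∀ (F : T3Family) (γ : ℝ) (hF : F.L = L), 0 < γ → γ ≤ γ₁ →
          Summit.QuantumFields.YangMills.Theorems.AlphaInputsT3AC.OfV3At F (hF ▸ 𝔠) a₀ a₁ →
            ∃ (D : AlphaDataT3 F γ) (PT : TermFn F),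
              RepAtHeights D 𝔠.b₀ 𝔠.p₀ ε₀ ∧ PintDecompTrivT D PT ∧ TwoRunMinT D PT 𝔠.b₀ 𝔠.p₀ a := by
  intro L hLo h7 𝔠 a₀ a₁ ha0 ha1 hw
  obtain ⟨a, ha, γB, hγB, hBC⟩ := stub_pintDecompTwoRunMinFam L hLo h7 𝔠 a₀ a₁ ha0 ha1 hw
  refine ⟨a₀, ha0, a, ha, fun ε₀ hε hhi => ?_⟩
  obtain ⟨γT, hγT, -, hT⟩ := Summit.QuantumFields.YangMills.Theorems.LogComparisonAlphaAdapter.exists_gamma_thresholds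
    (B₃ := 𝔠.B₃) 𝔠.b₀_pos 𝔠.p₀_pos ha1 𝔠.B₃_pos.le hε
  have hg0 : 0 < (min 𝔠.gamma0 1) ^ 2 := pow_pos (lt_min 𝔠.gamma0_pos one_pos) 2
  refine ⟨min γB (min γT ((min 𝔠.gamma0 1) ^ 2)), lt_min hγB (lt_min hγT hg0), fun F γ hF hγ hγ₁ hOf => ?_⟩
  subst hF
  have hγB' : γ ≤ γB := hγ₁.trans (min_le_left _ _)
  have hγT' : γ ≤ γT := hγ₁.trans ((min_le_right _ _).trans (min_le_left _ _))
  have hγ1 : γ ≤ (min 𝔠.gamma0 1) ^ 2 := hγ₁.trans ((min_le_right _ _).trans (min_le_right _ _))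
  obtain ⟨p, hp, π, PT, hB, hC⟩ := hBC F γ rfl hγ hγB' hγ1 hOf
  obtain ⟨hT1, hT2, hT3⟩ := hT F.L F.hL.2.le γ hγ hγT'
  exact ⟨Summit.QuantumFields.YangMills.Theorems.AlphaInputsT3AC.dataOfV3 p π, PT,
    Summit.QuantumFields.YangMills.Theorems.AlphaInputsT3AC.repAtHeights_dataOfV3 p π hp ε₀ hε hhi hT1 hT2 hT3, hB, hC⟩

/-- The two-run log-comparison in the v3′ order (thresholds first): for each odd `L > 1` — L ≥ 7: thresholds from STUB 2′; for a profile beyond them the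
record `𝔠` with `(𝔠.b₀, 𝔠.p₀) = (b₀, p₀)`; `ε₁(𝔠), a(𝔠)` from the α-adapter theorem `alphaTwoRunOfLaneV3` ((A) proved + STUB 3″); `m₀` from the landed S-E″ at `a`; per family the datum `D`, `CauchyAtHeights`, and the
socket `LogComparisonSocket.stubBody_of_rep_of_cauchy` (p452026); L < 7: STUB 4′ verbatim. [cite: King1986, Thm 3.4 (3.9) p.656] -/
theorem logComparisonRegPrL :
    ∀ (L : ℕ), Odd L → 1 < L → ∃ (b₁ p₁ : ℝ), ∀ (b₀ p₀ : ℝ), b₁ ≤ b₀ → p₁ ≤ p₀ → 0 < b₀ → 2 < p₀ →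
      ∃ ε₁ : ℝ, 0 < ε₁ ∧ ∀ (ε₀ : ℝ), 0 < ε₀ → ε₀ ≤ ε₁ → ∃ m₀ : ℕ, ∀ (m : ℕ), m₀ ≤ m →
        ∃ γ₁ : ℝ, 0 < γ₁ ∧ ∀ (F : T3Family) (γ : ℝ), F.L = L → 0 < γ → γ ≤ γ₁ →
          ∃ (r κ : ℕ → ℝ), Summable r ∧ (∀ K, 0 ≤ r K) ∧
            ∀ K, ∀ᵐ V ∂fieldMeasure (F.P (K / m)) 0 (Matrix.specialUnitaryGroup (Fin 2) ℂ),
              PlaqSmall (θBal F.L γ b₀ p₀ (K / m)) V →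
                0 < heightDensity F γ (Nat.div_le_self K m) (histGood F ℰp (θBal F.L γ b₀ p₀) K (K / m)) V →
                0 < heightDensity F γ ((Nat.div_le_self K m).trans (Nat.le_succ K))
                      (histGood F ℰp (θBal F.L γ b₀ p₀) (K + 1) (K / m)) V →
                  |(Real.log (heightDensity F γ ((Nat.div_le_self K m).trans (Nat.le_succ K))
                        (histGood F ℰp (θBal F.L γ b₀ p₀) (K + 1) (K / m)) V) + bgRegPr' F γ m ε₀ K V) -
                    (Real.log (heightDensity F γ (Nat.div_le_self K m) (histGood F ℰp (θBal F.L γ b₀ p₀) K (K / m)) V) + bgRegPr F γ m ε₀ K V) -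
                      κ K| ≤ r K := by
  intro L hLo hL
  by_cases h7 : 7 ≤ L
  swap
  · exact stub_logComparisonSmallBlocks L hLo hL (not_le.mp h7)
  obtain ⟨b₁, p₁, hrec⟩ := stub_laneRecordsV3 L hLo hL
  refine ⟨b₁, p₁, fun b₀ p₀ hb1 hp1 hb hp => ?_⟩
  obtain ⟨𝔠, a₀, a₁, hcb, hcp, ha0, ha1, hw, h𝔠⟩ := hrec b₀ p₀ hb1 hp1
  subst hcb
  subst hcp
  obtain ⟨εa, hεa, a, ha, hA⟩ := alphaTwoRunOfLaneV3 L hLo h7 𝔠 a₀ a₁ ha0 ha1 hw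
  obtain ⟨εs, hεs, hS⟩ := landed_levelCauchyOfTwoRunMinT L hLo hL a ha
  refine ⟨min εa εs, lt_min hεa hεs, fun ε₀ h0 h1 => ?_⟩
  have h1a : ε₀ ≤ εa := h1.trans (min_le_left _ _)
  have h1s : ε₀ ≤ εs := h1.trans (min_le_right _ _)
  obtain ⟨m₀, hm₀⟩ := hS ε₀ h0 h1s
  refine ⟨max m₀ 1, fun m hm => ?_⟩
  have hmpos : 0 < m := Nat.lt_of_lt_of_le Nat.one_pos ((le_max_right _ _).trans hm)
  obtain ⟨γa, hγa, hA'⟩ := hA ε₀ h0 h1a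
  obtain ⟨γs, hγs, hS'⟩ := hm₀ m ((le_max_left _ _).trans hm) 𝔠.b₀ 𝔠.p₀ hb hp
  refine ⟨min γa γs, lt_min hγa hγs, fun F γ hF hγ hγ₁ => ?_⟩
  have hγa' : γ ≤ γa := hγ₁.trans (min_le_left _ _)
  have hγs' : γ ≤ γs := hγ₁.trans (min_le_right _ _)
  obtain ⟨D, PT, hRep, hDec, hTwo⟩ := hA' F γ hF hγ hγa' (h𝔠 F hF)
  have hCau : CauchyAtHeights D 𝔠.b₀ 𝔠.p₀ m := hS' F γ hF hγ hγs' D PT hDec hTwo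
  exact Summit.QuantumFields.YangMills.Theorems.LogComparisonSocket.stubBody_of_rep_of_cauchy F γ 𝔠.b₀ 𝔠.p₀ ε₀ hmpos
    D.PintH D.EcstH D.RmH hRep hCau

/-- The old registered `stub_posOnSmall` (birth 04793f26c2da46ec), a THEOREM modulo STUB 1 ALONE (statement verbatim; «Lemma B» landed p446430; v5j′ REV 2: composed with the RE-LISTED `stub_oneStepSmallLift`, not with p494511 — F-owner-g20-2). -/
theorem posOnSmall :
    ∀ (L m : ℕ), 0 < m → ∀ (b₀ p₀ : ℝ), 0 < b₀ → 2 < p₀ → ∃ γ₁ : ℝ, 0 < γ₁ ∧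
      ∀ (F : T3Family) (γ : ℝ), F.L = L → 0 < γ → γ ≤ γ₁ →
        ∀ K, ∀ᵐ V ∂fieldMeasure (F.P (K / m)) 0 (Matrix.specialUnitaryGroup (Fin 2) ℂ),
          PlaqSmall (θBal F.L γ b₀ p₀ (K / m)) V →
            0 < heightDensity F γ (Nat.div_le_self K m) (histGood F ℰp (θBal F.L γ b₀ p₀) K (K / m)) V ∧
            0 < heightDensity F γ ((Nat.div_le_self K m).trans (Nat.le_succ K))
                  (histGood F ℰp (θBal F.L γ b₀ p₀) (K + 1) (K / m)) V :=
  -- v5j′ REV 2 (owner, F-owner-g20-2): CONDITIONAL on STUB 1 again — `posOnSmall_of_oneStepSmallLift` (p446430, axioms standard) ∘ `stub_oneStepSmallLift`; the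
  -- unconditional p494511 `PosOnSmall.posOnSmall` composes with p490827 whose L = 3 branch carries `native_decide` axioms and is therefore not used in the cone.
  Summit.QuantumFields.YangMills.Theorems.OneStepSubmersion.posOnSmall_of_oneStepSmallLift stub_oneStepSmallLift

/-- **`FluctuationComparisonRegPrL ⇐ stub_laneRecordsV3 ∧ stub_pintDecompTwoRunMinFam ∧ stub_logComparisonSmallBlocks`** (STUB 1 landed, (A) proved, S-E″ landed) — the NEW
load-bearing item stmt-QuantumFields-19935 BY NAME (S-E″ landed p479105/p479478; positivity via p446430 ∘ p443013 ∘ p428548; socket p452026). -/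
theorem FluctuationComparisonRegPrL_of : Summit.QuantumFields.YangMills.Theses.UnitScaleTilt.FluctuationComparisonRegPrL := by
  intro L
  by_cases hL : Odd L ∧ 1 < L
  · obtain ⟨b₁, p₁, hT⟩ := logComparisonRegPrL L hL.1 hL.2
    refine ⟨b₁, p₁, fun b₀ p₀ hb1 hp1 hb hp => ?_⟩
    obtain ⟨ε₁, hε₁, hε⟩ := hT b₀ p₀ hb1 hp1 hb hp
    refine ⟨ε₁, hε₁, fun ε₀ h0 h1 => ?_⟩
    obtain ⟨m₀, hm₀⟩ := hε ε₀ h0 h1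
    refine ⟨max m₀ 1, fun m hm => ?_⟩
    have hm₀' : m₀ ≤ m := (le_max_left _ _).trans hm
    have hmpos : 0 < m := Nat.lt_of_lt_of_le Nat.one_pos ((le_max_right _ _).trans hm)
    obtain ⟨γa, hγa, ha⟩ := posOnSmall L m hmpos b₀ p₀ hb hp
    obtain ⟨γb, hγb, hb'⟩ := hm₀ m hm₀'
    refine ⟨min γa γb, lt_min hγa hγb, fun F γ hFL hγ hγ₁ => ?_⟩
    have hP := ha F γ hFL hγ (hγ₁.trans (min_le_left _ _))
    obtain ⟨r, κ, hr, hr0, hC⟩ := hb' F γ hFL hγ (hγ₁.trans (min_le_right _ _))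
    refine ⟨r, κ, hr, hr0, fun K => ?_⟩
    filter_upwards [hP K, hC K] with V hVp hVc
    intro hs
    obtain ⟨h0', h1'⟩ := hVp hs
    exact ⟨h0', h1', hVc hs h0' h1'⟩
  · refine ⟨0, 0, fun b₀ p₀ _ _ _ _ => ⟨1, one_pos, fun ε₀ _ _ => ⟨0, fun m _ => ⟨1, one_pos, fun F γ hFL _ _ => ?_⟩⟩⟩⟩
    have hF := F.hL
    rw [hFL] at hF
    exact (hL hF).elim

end Summit.QuantumFields.YangMills.Cruxes.FluctuationComparisonRegPrL.BirthV5jFam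

end
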